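import Summits.Schanuel.Schanuel.Theorems.RootDecomp1ResidueSieveCells

/-!
# RootDecomp1ResidueSieve — continuation (RootDecomp1ResidueSieveFourExp): §2 the (2,0) cell under the Four Exponentials Conjecture: arg-rich power planes (…_powerPlane_of_fourExp, member z_F = e^π·(1,π,π²)) + §3 the value-rich cell (…_valRich_three)

Part of the four-file split (400-line rule) of lens 1's gen-16 node «ResidueSieve» = HOME/decomp-schanuel-lens-1/g16/RootDecomp1ResidueSieve.lean (sha256 563fa3ea…, 1084 l; ROUND 16 of
route-Schanuel-RootDecomp1, THEOREM ROUND; critic VERDICT 2026-08-30T18:15:03Z ACCEPTED; `--supports stmt-Schanuel-30353`); shared namespace `Summit.Schanuel.Schanuel.Theorems.RootDecomp1ResidueSieve`, node header block repeated; the first part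
(`RootDecomp1ResidueSieveCells`) carries the node docstring. WORDING OF RECORD (critic, binding): «D₃ sieve: residue = Cell(1,1) ∪ Cell(2,0); Cell(2,0) ∩ arg-rich power planes decided CONDITIONALLY on
FourExponentialsConjecture (member z_F certified); D decided (holds) at z* = (π, πi, log π) ON THE DISJOINT STRATUM (ε = 0 is the item's binder) by a = 1, v = 2 (Nesterenko) — Schanuel at z* OPEN;
value-rich members are calibration-grade». Sorry-free; standard axioms. Nothing here proves Schanuel; rung 0.
-/


noncomputable section

namespace Summit.Schanuel.Schanuel.Theorems.RootDecomp1ResidueSieve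

open Complex IntermediateField Module Polynomial
open Literature.NumberTheory.Transcendental (exists_nsmul_mem_span_int nesterenko transcendental_pi_holds
  FourExponentialsConjecture)
open Summit.Schanuel.Schanuel.Theorems.RootDecomp1EAnchor (isAlgebraic_of_mem_adjoin isAlgebraic_mul isAlgebraic_add
  trdeg_adjoin_union_le trdeg_adjoin_le_nat trdeg_adjoin_le_of_isAlgebraic exists_nat_eq_of_le_natCast)
open Summit.Schanuel.Schanuel.Theorems.RootDecomp1EEStableRung (one_le_trdeg_adjoin_of_transcendental
  mul_mem_span_of_gens)
open Summit.Schanuel.Schanuel.Theorems.RootDecomp1ArgumentCells (trdeg_args_le trdeg_vals_le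
  le_trdeg_of_algebraicIndependent_mem le_valDegree_of_exp_algebraic_mem algebraicIndependent_pi_exp_pi
  trdeg_args_le_one_of_isAlgebraic_adjoin_singleton)
open Summit.Schanuel.Schanuel.Theorems.RootDecomp1ValueCells (exp_mem_vals_of_mem_span_int exp_isAlgebraic_vals_of_mem_span)
open Summit.Schanuel.Schanuel.Theorems.RootDecomp1AdditiveCells (linearIndependent_mul_left le_trdeg_of_additive_cert)
open Summit.Schanuel.Schanuel.Theorems.RootDecomp1AdditiveCellsD (pair_one_linearIndependent)

/-- `π` is transcendental as a complex number (tree theorem `transcendental_pi_holds`, transported along `ℝ → ℂ`). -/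
private theorem transcendental_pi_complex : Transcendental ℚ (Real.pi : ℂ) :=
  (transcendental_algebraMap_iff (R := ℚ) (A := ℂ) Complex.ofReal_injective).mpr transcendental_pi_holds

/-- A transcendental number is non-zero. -/
private theorem ne_zero_of_transcendental {w : ℂ} (hw : Transcendental ℚ w) : w ≠ 0 := by
  rintro rfl
  exact hw isAlgebraic_zero


/-! ## §2  THE `(2,0)` CELL UNDER THE FOUR EXPONENTIALS CONJECTURE: arg-rich POWER PLANES `y₀·(1, ρ, ρ²)`

Cell `(2,0)` (`trdeg ℚ(z) = 2`, all three values algebraic, `ε = 0`, proper sub-spans Schanuel-tight) contains NO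
point under the conjecture of algebraic independence of logarithms (then `z ⊂ 𝓛` ℚ-free forces `trdeg ℚ(z) = 3`):
deciding it as typed is AIL-hard in general.  But on the POWER PLANES `V = y₀·span(1, ρ, ρ²)` the three arguments
form the `2 × 2` exponential GRID `x = (1, ρ)`, `y = (y₀, y₀ρ)` (`x_i y_j ∈ {y₀, y₀ρ, y₀ρ, y₀ρ²}`), so the registered
FOUR EXPONENTIALS CONJECTURE (`Literature…FourExponentialsConjecture`, strictly below Schanuel in the tree:
`fourExponentialsConjecture_of_schanuel`, `fourExponentialsConjecture_of_waldschmidtConjecture_2_3`) forbids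
«all values algebraic» there: it supplies the value floor `1 ≤ trdeg ℚ(e^z)` that Brownawell–Waldschmidt supplies
unconditionally on power LINES `(w, w², w³)` (round 15) but NOT on power planes with a transcendental base `y₀`
algebraically independent of `ρ` (there `trdeg ℚ(x, y) = 2` and the «Moreover» clause of Theorem 2.9 is void). -/

/-- The power plane `y₀·(1, ρ, ρ²)`. -/
def powerPlane (y₀ ρ : ℂ) : Fin 3 → ℂ := ![y₀, y₀ * ρ, y₀ * ρ ^ 2]

/-- `powerPlane y₀ ρ 0 = y₀`. -/
@[simp] theorem powerPlane_zero (y₀ ρ : ℂ) : powerPlane y₀ ρ 0 = y₀ := rfl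
/-- `powerPlane y₀ ρ 1 = y₀ * ρ`. -/
@[simp] theorem powerPlane_one (y₀ ρ : ℂ) : powerPlane y₀ ρ 1 = y₀ * ρ := rfl
/-- `powerPlane y₀ ρ 2 = y₀ * ρ ^ 2`. -/
@[simp] theorem powerPlane_two (y₀ ρ : ℂ) : powerPlane y₀ ρ 2 = y₀ * ρ ^ 2 := rfl

/-- Membership in `span_ℚ (y₀, y₀ρ, y₀ρ²)` in coordinates. -/
theorem mem_span_powerPlane_iff {y₀ ρ v : ℂ} :
    v ∈ Submodule.span ℚ (Set.range (powerPlane y₀ ρ)) ↔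
      ∃ c : Fin 3 → ℚ, (c 0 : ℂ) * y₀ + (c 1 : ℂ) * (y₀ * ρ) + (c 2 : ℂ) * (y₀ * ρ ^ 2) = v := by
  rw [Submodule.mem_span_range_iff_exists_fun]
  refine exists_congr fun c => ?_
  simp [Fin.sum_univ_three, Rat.smul_def]

/-- `(1, ρ, ρ²)`-type freeness: `y₀·(1, ρ, ρ²)` is ℚ-free for `y₀ ≠ 0`, `ρ ∉ ℚ̄`. -/
theorem powerPlane_linearIndependent {y₀ ρ : ℂ} (hy : y₀ ≠ 0) (hρ : Transcendental ℚ ρ) :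
    LinearIndependent ℚ (powerPlane y₀ ρ) := by
  rw [Fintype.linearIndependent_iff]
  intro g hg
  have hsum : (g 0 : ℂ) * y₀ + (g 1 : ℂ) * (y₀ * ρ) + (g 2 : ℂ) * (y₀ * ρ ^ 2) = 0 := by
    simpa [Fin.sum_univ_three, Rat.smul_def] using hg
  have hsum' : (g 0 : ℂ) + (g 1 : ℂ) * ρ + (g 2 : ℂ) * ρ ^ 2 = 0 := by
    have : y₀ * ((g 0 : ℂ) + (g 1 : ℂ) * ρ + (g 2 : ℂ) * ρ ^ 2) = y₀ * 0 := by
      rw [mul_zero]; linear_combination hsum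
    exact mul_left_cancel₀ hy this
  set p : ℚ[X] := C (g 0) + C (g 1) * X ^ 1 + C (g 2) * X ^ 2 with hp
  have hpw : aeval ρ p = 0 := by
    simp only [hp, map_add, map_mul, aeval_C, map_pow, aeval_X, eq_ratCast, pow_one]
    exact hsum'
  have hp0 : p = 0 := (transcendental_iff.mp hρ) p hpw
  have hc : ∀ k : ℕ, p.coeff k = 0 := fun k => by rw [hp0, coeff_zero]
  have h0 := hc 0
  have h1 := hc 1
  have h2 := hc 2
  simp only [hp, coeff_add, coeff_C_mul_X_pow, coeff_C] at h0 h1 h2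
  norm_num at h0 h1 h2
  intro i
  fin_cases i
  · exact h0
  · exact h1
  · exact h2

/-- **POWER PLANES ARE PLAIN** (`y₀ ≠ 0`, `ρ ∉ ℚ̄`): every multiplier of `span_ℚ y₀·(1, ρ, ρ²)` is rational — no
irrational algebraic multiplier, so these spans lie OUTSIDE round 14's E-stable stratum (and outside the
Lindemann–Weierstrass cells when `dim (V ∩ ℚ̄) ≤ 1`, e.g. for `y₀, ρ` algebraically independent, below). -/
theorem powerPlane_plain {y₀ ρ : ℂ} (hy : y₀ ≠ 0) (hρ : Transcendental ℚ ρ) {β : ℂ}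
    (hβ : ∀ i, β * powerPlane y₀ ρ i ∈ Submodule.span ℚ (Set.range (powerPlane y₀ ρ))) :
    β ∈ Set.range (algebraMap ℚ ℂ) := by
  obtain ⟨c, hc⟩ := mem_span_powerPlane_iff.mp (hβ 0)
  obtain ⟨d, hd⟩ := mem_span_powerPlane_iff.mp (hβ 2)
  simp only [powerPlane_zero, powerPlane_two] at hc hd
  have hβ' : β = (c 0 : ℂ) + (c 1 : ℂ) * ρ + (c 2 : ℂ) * ρ ^ 2 := by
    have : ((c 0 : ℂ) + (c 1 : ℂ) * ρ + (c 2 : ℂ) * ρ ^ 2) * y₀ = β * y₀ := by rw [← hc]; ring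
    exact (mul_right_cancel₀ hy this).symm
  have hrel : (d 0 : ℂ) + (d 1 : ℂ) * ρ + ((d 2 : ℂ) - (c 0 : ℂ)) * ρ ^ 2 - (c 1 : ℂ) * ρ ^ 3
      - (c 2 : ℂ) * ρ ^ 4 = 0 := by
    have : y₀ * ((d 0 : ℂ) + (d 1 : ℂ) * ρ + ((d 2 : ℂ) - (c 0 : ℂ)) * ρ ^ 2 - (c 1 : ℂ) * ρ ^ 3
        - (c 2 : ℂ) * ρ ^ 4) = y₀ * 0 := by
      rw [hβ'] at hd
      rw [mul_zero]; linear_combination hd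
    exact mul_left_cancel₀ hy this
  set p : ℚ[X] := C (d 0) + C (d 1) * X ^ 1 + C (d 2 - c 0) * X ^ 2 - C (c 1) * X ^ 3 - C (c 2) * X ^ 4
    with hp
  have hpw : aeval ρ p = 0 := by
    simp only [hp, map_add, map_sub, map_mul, aeval_C, map_pow, aeval_X, eq_ratCast, pow_one]
    exact hrel
  have hp0 : p = 0 := (transcendental_iff.mp hρ) p hpw
  have hcoef : ∀ k : ℕ, p.coeff k = 0 := fun k => by rw [hp0, coeff_zero]
  have h3 := hcoef 3
  have h4 := hcoef 4
  simp only [hp, coeff_add, coeff_sub, coeff_C_mul_X_pow, coeff_C] at h3 h4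
  norm_num at h3 h4
  refine ⟨c 0, ?_⟩
  rw [hβ', h3, h4]
  simp

/-- The four products of the grid `x = (1, ρ)`, `y = (y₀, y₀ρ)` are entries of the power plane. -/
theorem grid_mem_powerPlane (y₀ ρ : ℂ) (i j : Fin 2) :
    ∃ k : Fin 3, ![(1 : ℂ), ρ] i * ![y₀, y₀ * ρ] j = powerPlane y₀ ρ k := by
  fin_cases i <;> fin_cases j
  · exact ⟨0, by simp⟩
  · exact ⟨1, by simp⟩
  · exact ⟨1, by simp [mul_comm]⟩
  · exact ⟨2, by simp [powerPlane]; ring⟩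

/-- **FEC VALUE FLOOR ON POWER PLANES.**  Under the Four Exponentials Conjecture, `y₀ ≠ 0` and `(1, ρ)` ℚ-free give a
transcendental value among `e^{y₀}, e^{y₀ρ}, e^{y₀ρ²}` … -/
theorem exists_transcendental_exp_powerPlane_of_fourExp (hF : FourExponentialsConjecture) {y₀ ρ : ℂ}
    (hy : y₀ ≠ 0) (hρ : LinearIndependent ℚ ![(1 : ℂ), ρ]) :
    ∃ k, Transcendental ℚ (cexp (powerPlane y₀ ρ k)) := by
  have hy' : LinearIndependent ℚ ![y₀, y₀ * ρ] := by
    have h := linearIndependent_mul_left hρ hy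
    have e : (fun i => y₀ * (![(1 : ℂ), ρ] : Fin 2 → ℂ) i) = ![y₀, y₀ * ρ] := by
      funext i
      fin_cases i <;> simp
    rwa [e] at h
  obtain ⟨i, j, hij⟩ := hF ![(1 : ℂ), ρ] ![y₀, y₀ * ρ] hρ hy'
  obtain ⟨k, hk⟩ := grid_mem_powerPlane y₀ ρ i j
  exact ⟨k, hk ▸ hij⟩

/-- … hence `1 ≤ trdeg ℚ(e^{y₀}, e^{y₀ρ}, e^{y₀ρ²})`. -/
theorem one_le_valDegree_powerPlane_of_fourExp (hF : FourExponentialsConjecture) {y₀ ρ : ℂ}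
    (hy : y₀ ≠ 0) (hρ : LinearIndependent ℚ ![(1 : ℂ), ρ]) :
    (1 : Cardinal) ≤ Algebra.trdeg ℚ ↥(adjoin ℚ (Set.range (cexp ∘ powerPlane y₀ ρ))) := by
  obtain ⟨k, hk⟩ := exists_transcendental_exp_powerPlane_of_fourExp hF hy hρ
  exact one_le_trdeg_adjoin_of_transcendental hk ⟨k, rfl⟩

/-- **ARG-RICH POWER PLANES have argument degree 2**: `y₀, ρ = z₁/z₀ ∈ ℚ(z)` algebraically independent. -/
theorem two_le_argDegree_powerPlane {y₀ ρ : ℂ} (hai : AlgebraicIndependent ℚ ![y₀, ρ]) :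
    (2 : Cardinal) ≤ Algebra.trdeg ℚ ↥(adjoin ℚ (Set.range (powerPlane y₀ ρ))) := by
  have hy : y₀ ≠ 0 := ne_zero_of_transcendental (by simpa using hai.transcendental 0)
  have h0 : y₀ ∈ adjoin ℚ (Set.range (powerPlane y₀ ρ)) := subset_adjoin ℚ _ ⟨0, rfl⟩
  have h1 : y₀ * ρ ∈ adjoin ℚ (Set.range (powerPlane y₀ ρ)) := subset_adjoin ℚ _ ⟨1, rfl⟩
  have hρ : ρ ∈ adjoin ℚ (Set.range (powerPlane y₀ ρ)) := by
    have e : y₀ * ρ / y₀ = ρ := by field_simp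
    have h := div_mem h1 h0
    rwa [e] at h
  have h := le_trdeg_of_algebraicIndependent_mem (adjoin ℚ (Set.range (powerPlane y₀ ρ))) hai
    (fun i => by fin_cases i <;> simp [h0, hρ])
  exact_mod_cast h

/-- **THE FEC CELL (pointwise): item D HOLDS on every arg-rich power plane under the Four Exponentials Conjecture**
— `a = 2` (Nesterenko-free: `y₀, ρ` algebraically independent by hypothesis), `v ≥ 1` (FEC on the grid), `ε = 0`,
`2 + 1 = 3`.  These planes lie in the sieve's cell `(2,0) ∪ decided`; FEC is what removes `(2,0)` for them. -/
theorem disjointSchanuel_powerPlane_argRich_of_fourExp (hF : FourExponentialsConjecture) {y₀ ρ : ℂ}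
    (hai : AlgebraicIndependent ℚ ![y₀, ρ])
    (hsplit : Algebra.trdeg ℚ ↥(adjoin ℚ (Set.range (powerPlane y₀ ρ))) +
        Algebra.trdeg ℚ ↥(adjoin ℚ (Set.range (cexp ∘ powerPlane y₀ ρ))) ≤
      Algebra.trdeg ℚ ↥(adjoin ℚ (Set.range (powerPlane y₀ ρ) ∪ Set.range (cexp ∘ powerPlane y₀ ρ)))) :
    ((3 : ℕ) : Cardinal) ≤
      Algebra.trdeg ℚ ↥(adjoin ℚ (Set.range (powerPlane y₀ ρ) ∪ Set.range (cexp ∘ powerPlane y₀ ρ))) := by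
  have hy : y₀ ≠ 0 := ne_zero_of_transcendental (by simpa using hai.transcendental 0)
  have hρ : Transcendental ℚ ρ := by simpa using hai.transcendental 1
  exact le_trdeg_of_additive_cert _ (a := 2) (v := 1) (by exact_mod_cast two_le_argDegree_powerPlane hai)
    (by exact_mod_cast one_le_valDegree_powerPlane_of_fourExp hF hy (pair_one_linearIndependent hρ)) hsplit
    (by norm_num)

/-- **THE FEC CELL (item form, binders of stmt-Schanuel-30353 verbatim): `FourExponentialsConjecture ⟹ D` on the
cell `{n = 3, z an arg-rich power plane}`** — the STRUCTURE theorem of this round: a registered conjecture strictly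
below Schanuel decides a named cell of D's residue that no unconditional instrument in the tree reaches. -/
theorem disjointSaturatedEssentialSchanuel_powerPlane_of_fourExp (hF : FourExponentialsConjecture) :
    ∀ (n : ℕ), 3 ≤ n → ∀ (z : Fin n → ℂ), LinearIndependent ℚ z →
      (n ≤ 3 ∧ ∃ y₀ ρ : ℂ, AlgebraicIndependent ℚ ![y₀, ρ] ∧ Set.range z = Set.range (powerPlane y₀ ρ)) →
      (∀ i, z i ∈ Literature.NumberTheory.Transcendental.ecl (∅ : Set ℂ)) →
      (∀ (m : ℕ), m < n → ∀ (w : Fin m → ℂ), LinearIndependent ℚ w →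
        (∀ i, w i ∈ Submodule.span ℚ (Set.range z)) →
        (m : Cardinal) ≤ Algebra.trdeg ℚ ↥(IntermediateField.adjoin ℚ (Set.range w ∪ Set.range (Complex.exp ∘ w)))) →
      (∀ w : ℂ, IsAlgebraic ↥(IntermediateField.adjoin ℚ (Set.range z ∪ Set.range (Complex.exp ∘ z))) w →
        IsAlgebraic ↥(IntermediateField.adjoin ℚ (Set.range z ∪ Set.range (Complex.exp ∘ z))) (Complex.exp w) →
        w ∈ Submodule.span ℚ (Set.range z)) →
      (∀ (k : ℕ) (t : Fin k → ℂ) (β₀ γ₀ : Fin n → ℂ) (β γ : Fin n → Fin k → ℂ), (∀ i, IsAlgebraic ℚ (β₀ i)) →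
        (∀ i j, IsAlgebraic ℚ (β i j)) → (∀ i, IsAlgebraic ℚ (γ₀ i)) → (∀ i j, IsAlgebraic ℚ (γ i j)) →
        (∀ i, z i = β₀ i + ∑ j, β i j * t j) → (∀ i, Complex.exp (z i) = γ₀ i + ∑ j, γ i j * t j) → n ≤ k) →
      (∀ (k : ℕ) (t : Fin k → ℂ) (β₀ γ₀ : Fin n → ℂ) (β γ : Fin n → Fin k → ℂ) (δ ε : Fin n → Fin k → Fin k → ℂ),
        (∀ i, IsAlgebraic ℚ (β₀ i)) → (∀ i j, IsAlgebraic ℚ (β i j)) → (∀ i j j', IsAlgebraic ℚ (δ i j j')) →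
        (∀ i, IsAlgebraic ℚ (γ₀ i)) → (∀ i j, IsAlgebraic ℚ (γ i j)) → (∀ i j j', IsAlgebraic ℚ (ε i j j')) →
        (∀ i, z i = β₀ i + ∑ j, β i j * t j + ∑ j, ∑ j', δ i j j' * (t j * t j')) →
        (∀ i, Complex.exp (z i) = γ₀ i + ∑ j, γ i j * t j + ∑ j, ∑ j', ε i j j' * (t j * t j')) → n ≤ k) →
      (∀ (k : ℕ) (t : Fin k → ℂ) (D : MvPolynomial (Fin k) ℂ) (N E : Fin n → MvPolynomial (Fin k) ℂ),
        (∀ m, IsAlgebraic ℚ (MvPolynomial.coeff m D)) → (∀ i m, IsAlgebraic ℚ (MvPolynomial.coeff m (N i))) →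
        (∀ i m, IsAlgebraic ℚ (MvPolynomial.coeff m (E i))) → MvPolynomial.eval t D ≠ 0 →
        (∀ i, z i * MvPolynomial.eval t D = MvPolynomial.eval t (N i)) →
        (∀ i, Complex.exp (z i) * MvPolynomial.eval t D = MvPolynomial.eval t (E i)) → n ≤ k) →
      (Algebra.trdeg ℚ ↥(IntermediateField.adjoin ℚ (Set.range z)) +
          Algebra.trdeg ℚ ↥(IntermediateField.adjoin ℚ (Set.range (Complex.exp ∘ z))) ≤
        Algebra.trdeg ℚ ↥(IntermediateField.adjoin ℚ (Set.range z ∪ Set.range (Complex.exp ∘ z)))) →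
      (n : Cardinal) ≤ Algebra.trdeg ℚ ↥(IntermediateField.adjoin ℚ (Set.range z ∪ Set.range (Complex.exp ∘ z))) := by
  intro n hn z hz hcell _ _ _ _ _ _ hsplit
  obtain rfl : n = 3 := le_antisymm hcell.1 hn
  obtain ⟨y₀, ρ, hai, hzr⟩ := hcell.2
  have e1 : Set.range (Complex.exp ∘ z) = Set.range (cexp ∘ powerPlane y₀ ρ) := by
    rw [Set.range_comp, Set.range_comp, hzr]
  rw [e1, hzr] at hsplit ⊢
  exact disjointSchanuel_powerPlane_argRich_of_fourExp hF hai hsplit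

/-- **… and the sieve on power planes**: under FEC, item D at a ℚ-free power plane `y₀·(1, ρ, ρ²)` (`ρ ∉ ℚ̄`) reduces
to the single bidegree cell `(1,1)` — FEC empties the `(2,0)` branch. -/
theorem disjointSchanuel_powerPlane_of_fourExp_of_cell11 (hF : FourExponentialsConjecture) {y₀ ρ : ℂ}
    (hy : y₀ ≠ 0) (hρ : Transcendental ℚ ρ)
    (hsplit : Algebra.trdeg ℚ ↥(adjoin ℚ (Set.range (powerPlane y₀ ρ))) +
        Algebra.trdeg ℚ ↥(adjoin ℚ (Set.range (cexp ∘ powerPlane y₀ ρ))) ≤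
      Algebra.trdeg ℚ ↥(adjoin ℚ (Set.range (powerPlane y₀ ρ) ∪ Set.range (cexp ∘ powerPlane y₀ ρ))))
    (h11 : Algebra.trdeg ℚ ↥(adjoin ℚ (Set.range (powerPlane y₀ ρ))) ≤ 1 →
      Algebra.trdeg ℚ ↥(adjoin ℚ (Set.range (cexp ∘ powerPlane y₀ ρ))) ≤ 1 →
      ((3 : ℕ) : Cardinal) ≤
        Algebra.trdeg ℚ ↥(adjoin ℚ (Set.range (powerPlane y₀ ρ) ∪ Set.range (cexp ∘ powerPlane y₀ ρ)))) :
    ((3 : ℕ) : Cardinal) ≤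
      Algebra.trdeg ℚ ↥(adjoin ℚ (Set.range (powerPlane y₀ ρ) ∪ Set.range (cexp ∘ powerPlane y₀ ρ))) := by
  refine disjointSchanuel_three_of_cells _ (powerPlane_linearIndependent hy hρ) hsplit h11 fun halg => ?_
  obtain ⟨k, hk⟩ := exists_transcendental_exp_powerPlane_of_fourExp hF hy (pair_one_linearIndependent hρ)
  exact absurd (halg k) hk

/-! ### Member `z_F = e^π·(1, π, π²) = (e^π, πe^π, π²e^π)` — certified IN the cell (Nesterenko), D₃ there ⟸ FEC -/

/-- `z_F = (e^π, πe^π, π²e^π)`. -/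
def expPiPowerPlane : Fin 3 → ℂ := powerPlane (cexp (Real.pi : ℂ)) (Real.pi : ℂ)

/-- `(e^π, π)` is algebraically independent (Nesterenko, `algebraicIndependent_pi_exp_pi` reindexed). -/
theorem algebraicIndependent_expPi_pi (hN : nesterenko) :
    AlgebraicIndependent ℚ ![cexp (Real.pi : ℂ), (Real.pi : ℂ)] := by
  have h := (algebraicIndependent_pi_exp_pi hN).comp ![(1 : Fin 2), 0] (by decide)
  convert h using 1
  ext i
  fin_cases i <;> rfl

/-- **MEMBER `z_F`**: ℚ-free · PLAIN · argument degree `2` with `dim (V ∩ ℚ̄) = 0` (no non-zero algebraic point: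
`y₀ = e^π`, `ρ = π` algebraically independent) — so OUTSIDE the Lindemann–Weierstrass cells, the E-stable stratum and
the `a + v ≥ 3` zone of rounds 9/15 (its values `e^{e^π}, e^{πe^π}, e^{π²e^π}` are dark to every instrument in the
tree); and **item D at `z_F` follows from the Four Exponentials Conjecture**. -/
theorem member_expPiPowerPlane (hN : nesterenko) :
    LinearIndependent ℚ expPiPowerPlane ∧
    (∀ β : ℂ, (∀ i, β * expPiPowerPlane i ∈ Submodule.span ℚ (Set.range expPiPowerPlane)) →
      β ∈ Set.range (algebraMap ℚ ℂ)) ∧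
    (2 : Cardinal) ≤ Algebra.trdeg ℚ ↥(adjoin ℚ (Set.range expPiPowerPlane)) ∧
    (∀ v ∈ Submodule.span ℚ (Set.range expPiPowerPlane), IsAlgebraic ℚ v → v = 0) ∧
    (FourExponentialsConjecture →
      Algebra.trdeg ℚ ↥(adjoin ℚ (Set.range expPiPowerPlane)) +
          Algebra.trdeg ℚ ↥(adjoin ℚ (Set.range (cexp ∘ expPiPowerPlane))) ≤
        Algebra.trdeg ℚ ↥(adjoin ℚ (Set.range expPiPowerPlane ∪ Set.range (cexp ∘ expPiPowerPlane))) →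
      ((3 : ℕ) : Cardinal) ≤
        Algebra.trdeg ℚ ↥(adjoin ℚ (Set.range expPiPowerPlane ∪ Set.range (cexp ∘ expPiPowerPlane)))) := by
  have hai := algebraicIndependent_expPi_pi hN
  have hy : cexp (Real.pi : ℂ) ≠ 0 := Complex.exp_ne_zero _
  refine ⟨powerPlane_linearIndependent hy transcendental_pi_complex,
    fun _ hβ => powerPlane_plain hy transcendental_pi_complex hβ, two_le_argDegree_powerPlane hai, ?_,
    fun hF hsplit => disjointSchanuel_powerPlane_argRich_of_fourExp hF hai hsplit⟩
  intro v hv halg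
  obtain ⟨c, hc⟩ := mem_span_powerPlane_iff.mp hv
  set s : ℂ := (c 0 : ℂ) + (c 1 : ℂ) * (Real.pi : ℂ) + (c 2 : ℂ) * (Real.pi : ℂ) ^ 2 with hs
  have hvs : v = cexp (Real.pi : ℂ) * s := by rw [← hc, hs]; ring
  by_cases hs0 : s = 0
  · rw [hvs, hs0, mul_zero]
  · exfalso
    set K := adjoin ℚ ({(Real.pi : ℂ)} : Set ℂ) with hK
    have hπK : (Real.pi : ℂ) ∈ K := mem_adjoin_simple_self ℚ _
    have hq : ∀ q : ℚ, (q : ℂ) ∈ K := fun q => by simp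
    have hsK : s ∈ K :=
      add_mem (add_mem (hq _) (mul_mem (hq _) hπK)) (mul_mem (hq _) (pow_mem hπK 2))
    have halgK : IsAlgebraic K (cexp (Real.pi : ℂ)) := by
      have e : cexp (Real.pi : ℂ) = v * s⁻¹ := by rw [hvs]; field_simp
      rw [e]
      exact isAlgebraic_mul (halg.tower_top K) (isAlgebraic_of_mem_adjoin (inv_mem hsK))
    exact not_isAlgebraic_of_algebraicIndependent_pair (algebraicIndependent_pi_exp_pi hN) halgK


/-! ## §3  THE VALUE-RICH CELL `a ≥ 1, v ≥ 2` and its member `z* = (π, πi, log π)`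

Rounds 9/15 certified `3 ≤ t` additively through the ARGUMENT side (`a = 2` from an algebraically independent
pair such as `(π, e^π)` IN THE SPAN, `v ≥ 1`).  The mirror cell reads the algebraically independent pair on the
VALUE side: two points `u₀, u₁` of the span whose EXPONENTIALS are algebraically independent give `v ≥ 2`
(`e^{u_j}` is algebraic over `ℚ(e^z)`), and one transcendental point of the span gives `a ≥ 1`.  Its member
`z* = (π, πi, log π)` — values `(e^π, −1, π)` — is ℚ-free and PLAIN with `dim (V ∩ ℚ̄) ≤ 1` and NO certified
algebraically independent pair among its arguments (`(π, log π)` algebraically independent is open; even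
`log π ∉ ℚ` is open): a point of round 15's typed residue at which item D is now DECIDED (holds), while Schanuel's
conclusion there, `3 ≤ trdeg ℚ(π, log π, e^π)`, stays open. -/

/-- **VALUE CERTIFICATE BY A FREE VALUE FAMILY**: `m` points of `span_ℚ z` with algebraically independent
exponentials give `m ≤ trdeg ℚ(e^z)`. -/
theorem le_valDegree_of_expFamily {n m : ℕ} (z : Fin n → ℂ) (u : Fin m → ℂ)
    (hu : ∀ j, u j ∈ Submodule.span ℚ (Set.range z)) (hai : AlgebraicIndependent ℚ fun j => cexp (u j)) :
    (m : Cardinal) ≤ Algebra.trdeg ℚ ↥(adjoin ℚ (Set.range (cexp ∘ z))) := by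
  have h2 : (m : Cardinal) ≤ Algebra.trdeg ℚ ↥(adjoin ℚ (Set.range (cexp ∘ u))) :=
    le_trdeg_of_algebraicIndependent_mem _ hai fun j => subset_adjoin ℚ _ ⟨j, rfl⟩
  refine h2.trans (trdeg_adjoin_le_of_isAlgebraic ?_)
  rintro _ ⟨j, rfl⟩
  exact exp_isAlgebraic_vals_of_mem_span (hu j)

/-- One transcendental point of the span gives `1 ≤ trdeg ℚ(z)`. -/
theorem one_le_argDegree_of_transcendental_mem_span {n : ℕ} (z : Fin n → ℂ) {w : ℂ}
    (hw : w ∈ Submodule.span ℚ (Set.range z)) (hwt : Transcendental ℚ w) :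
    (1 : Cardinal) ≤ Algebra.trdeg ℚ ↥(adjoin ℚ (Set.range z)) := by
  have h1 := one_le_trdeg_adjoin_of_transcendental (S := ({w} : Set ℂ)) hwt rfl
  refine h1.trans (trdeg_adjoin_le_of_isAlgebraic ?_)
  rintro _ rfl
  exact isAlgebraic_of_mem_adjoin (mem_args_of_mem_span hw)

/-- **THE VALUE-RICH CELL (pointwise): item D HOLDS at length 3** when the span carries two points with
algebraically independent exponentials and one transcendental point (`a ≥ 1`, `v ≥ 2`, `ε = 0`, `1 + 2 = 3`). -/
theorem disjointSchanuel_three_cell_valRich (z : Fin 3 → ℂ) {u : Fin 2 → ℂ}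
    (hu : ∀ j, u j ∈ Submodule.span ℚ (Set.range z)) (hai : AlgebraicIndependent ℚ fun j => cexp (u j))
    {w : ℂ} (hw : w ∈ Submodule.span ℚ (Set.range z)) (hwt : Transcendental ℚ w)
    (hsplit : Algebra.trdeg ℚ ↥(adjoin ℚ (Set.range z)) + Algebra.trdeg ℚ ↥(adjoin ℚ (Set.range (cexp ∘ z))) ≤
      Algebra.trdeg ℚ ↥(adjoin ℚ (Set.range z ∪ Set.range (cexp ∘ z)))) :
    ((3 : ℕ) : Cardinal) ≤ Algebra.trdeg ℚ ↥(adjoin ℚ (Set.range z ∪ Set.range (cexp ∘ z))) :=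
  le_trdeg_of_additive_cert z (a := 1) (v := 2)
    (by exact_mod_cast one_le_argDegree_of_transcendental_mem_span z hw hwt)
    (le_valDegree_of_expFamily z u hu hai) hsplit (by norm_num)

/-- **THE VALUE-RICH CELL (item form, binders of stmt-Schanuel-30353 verbatim)** — a cell of item D DECIDED (holds)
inside round 15's residue `{plain, dim (V ∩ ℚ̄) ≤ 1, no certified a.i. argument pair}`: the certificate is read on
the value side. -/
theorem disjointSaturatedEssentialSchanuel_valRich_three :
    ∀ (n : ℕ), 3 ≤ n → ∀ (z : Fin n → ℂ), LinearIndependent ℚ z →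
      (n ≤ 3 ∧ (∃ u : Fin 2 → ℂ, (∀ j, u j ∈ Submodule.span ℚ (Set.range z)) ∧
        AlgebraicIndependent ℚ (fun j => Complex.exp (u j))) ∧
        ∃ w ∈ Submodule.span ℚ (Set.range z), Transcendental ℚ w) →
      (∀ i, z i ∈ Literature.NumberTheory.Transcendental.ecl (∅ : Set ℂ)) →
      (∀ (m : ℕ), m < n → ∀ (w : Fin m → ℂ), LinearIndependent ℚ w →
        (∀ i, w i ∈ Submodule.span ℚ (Set.range z)) →
        (m : Cardinal) ≤ Algebra.trdeg ℚ ↥(IntermediateField.adjoin ℚ (Set.range w ∪ Set.range (Complex.exp ∘ w)))) →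
      (∀ w : ℂ, IsAlgebraic ↥(IntermediateField.adjoin ℚ (Set.range z ∪ Set.range (Complex.exp ∘ z))) w →
        IsAlgebraic ↥(IntermediateField.adjoin ℚ (Set.range z ∪ Set.range (Complex.exp ∘ z))) (Complex.exp w) →
        w ∈ Submodule.span ℚ (Set.range z)) →
      (∀ (k : ℕ) (t : Fin k → ℂ) (β₀ γ₀ : Fin n → ℂ) (β γ : Fin n → Fin k → ℂ), (∀ i, IsAlgebraic ℚ (β₀ i)) →
        (∀ i j, IsAlgebraic ℚ (β i j)) → (∀ i, IsAlgebraic ℚ (γ₀ i)) → (∀ i j, IsAlgebraic ℚ (γ i j)) →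
        (∀ i, z i = β₀ i + ∑ j, β i j * t j) → (∀ i, Complex.exp (z i) = γ₀ i + ∑ j, γ i j * t j) → n ≤ k) →
      (∀ (k : ℕ) (t : Fin k → ℂ) (β₀ γ₀ : Fin n → ℂ) (β γ : Fin n → Fin k → ℂ) (δ ε : Fin n → Fin k → Fin k → ℂ),
        (∀ i, IsAlgebraic ℚ (β₀ i)) → (∀ i j, IsAlgebraic ℚ (β i j)) → (∀ i j j', IsAlgebraic ℚ (δ i j j')) →
        (∀ i, IsAlgebraic ℚ (γ₀ i)) → (∀ i j, IsAlgebraic ℚ (γ i j)) → (∀ i j j', IsAlgebraic ℚ (ε i j j')) →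
        (∀ i, z i = β₀ i + ∑ j, β i j * t j + ∑ j, ∑ j', δ i j j' * (t j * t j')) →
        (∀ i, Complex.exp (z i) = γ₀ i + ∑ j, γ i j * t j + ∑ j, ∑ j', ε i j j' * (t j * t j')) → n ≤ k) →
      (∀ (k : ℕ) (t : Fin k → ℂ) (D : MvPolynomial (Fin k) ℂ) (N E : Fin n → MvPolynomial (Fin k) ℂ),
        (∀ m, IsAlgebraic ℚ (MvPolynomial.coeff m D)) → (∀ i m, IsAlgebraic ℚ (MvPolynomial.coeff m (N i))) →
        (∀ i m, IsAlgebraic ℚ (MvPolynomial.coeff m (E i))) → MvPolynomial.eval t D ≠ 0 →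
        (∀ i, z i * MvPolynomial.eval t D = MvPolynomial.eval t (N i)) →
        (∀ i, Complex.exp (z i) * MvPolynomial.eval t D = MvPolynomial.eval t (E i)) → n ≤ k) →
      (Algebra.trdeg ℚ ↥(IntermediateField.adjoin ℚ (Set.range z)) +
          Algebra.trdeg ℚ ↥(IntermediateField.adjoin ℚ (Set.range (Complex.exp ∘ z))) ≤
        Algebra.trdeg ℚ ↥(IntermediateField.adjoin ℚ (Set.range z ∪ Set.range (Complex.exp ∘ z)))) →
      (n : Cardinal) ≤ Algebra.trdeg ℚ ↥(IntermediateField.adjoin ℚ (Set.range z ∪ Set.range (Complex.exp ∘ z))) := by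
  intro n hn z hz hcell _ _ _ _ _ _ hsplit
  obtain rfl : n = 3 := le_antisymm hcell.1 hn
  obtain ⟨⟨u, hu, hai⟩, w, hw, hwt⟩ := hcell.2
  exact disjointSchanuel_three_cell_valRich z hu hai hw hwt hsplit

end Summit.Schanuel.Schanuel.Theorems.RootDecomp1ResidueSieve
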